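import Summits.BirchSwinnertonDyer.BirchSwinnertonDyer.Theorems.SemiOrdinaryEisensteinDescentWildSigmaDivisibilityAtThreeMultiCarrierTight
import Summits.BirchSwinnertonDyer.Rank1Residual.X4.ThreeDescentRecords19
import Literature.NumberTheory.EllipticCurves.Rank1Residual.X11RankOneCertificates.Minimality
import Summits.BirchSwinnertonDyer.Rank1Residual.X5.TwoAdicInstancesToolkitD
import HarnessLib

/-!
# Crux J‴ `WildSigmaDivisibilityAtThreeMultiCarrier` (stmt-BirchSwinnertonDyer-25898): the FIRST COMPLETE INSTANCE, kernel form —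
# J‴'s conclusion on every frame over F₀ = (3105c1, K = ℚ(√−11)) from two exact 3-descent certificate lines and named print
# (route `SemiOrdinaryEisensteinDescent`; width seat `bsd-wall-soed-p2-w2` g15; instrument row A-J3-F0, director-bsd g15 grant 2026-08-28T18:47:14Z;
# `--supports stmt-BirchSwinnertonDyer-25898`, helper)

WHY. J‴ (σ-divisibility of the Kolyvagin points to the full depth `t = ord₃ ∏ c_q + v₃ c(Dt)` on MULTI-CARRIER frames of the onto wild
`r = 1` cell at `3`) is open research (`Cruxes/WildSigmaDivisibilityAtThreeMultiCarrier/Lines/birth.md`: Büyükboduk 2009 §4.2 Q1 at the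
additive prime `3`, between the barriers `StringentKolyvaginCapsAtMax` and `TraceZeroHeegnerTowerAtAdditiveSplitP`). By the lineage's TIGHT
theorem (`WildSigmaDivisibilityAtThreeMultiCarrierTight.sigma_at_of_bsdp_of_bsdp_towerFree`, p623556) J‴'s conclusion AT A FRAME follows from
`BSD₃(E) ∧ BSD₃(E^{d_K})` (Miller's `BSDp · 3` for a globally minimal model of each) modulo six named print facts. The cheapest frame of the
whole cell on which both BSD₃'s are reachable by EXACT 3-DESCENT is F₀ = (E = 3105c1, K = ℚ(√−11)) (vet tk5j g17, `twin_frames_g17`: the unique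
habitat frame whose rank-0 twist lies in Cremona's range): `N = 3105 = 3³·5·23`, `c₃ = 3` (IV), `c₅ = 6` (I₆), `c₂₃ = 1`, so `t = 2` with TWO
Tamagawa 3-carriers each of depth `1 < t` — a genuine multi-carrier frame of J‴ (and of `stub_flatMultiCarrier`); `−11` is a Heegner
discriminant for `3105` (`3, 5, 23` split), odd, `≠ −3`; `E^(−11) = 375705bp1 = [1,−1,0,−58284,−5434335]` (`N = 3³·5·11²·23`, `r_an = 0`,
`#Ш_an = 1`, `∏ c_p = 36`). Kit j316201 (this seat; x11b engine `desc3lib.gp` sha256 c4fb20b7… BYTE-IDENTICAL + gen-8 `entry.gp`, EXACT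
mode = `bnfcertify(A,1) = 1` + 3-saturation; `precheck.py` re-verifies in PARI that `375705bp1` IS the reduced minimal model of the twist,
`a_p(E^D) = χ_{−11}(p) a_p(E)` for `p < 1224`, Tate's `c_q`, the Heegner signs and the cut) supplies the certificate line
`dim Sel^(3)(375705bp1/ℚ) = 0`; kit j127101 (x11c GEN 15, tree record `X4.bsdp3_d3105c1`) supplied `dim Sel^(3)(3105c1/ℚ) = 1`.

WHAT IS PROVED (theorems only; no definition, no named fact, no `sorry`; standard axioms):
* §1 `smul_quadraticTwist_3105c1_eq` — the explicit `ℚ`-isomorphism `⟨1, −3, 1/2, 0⟩ • (3105c1)^{(−11)} = 375705bp1` for the tree's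
  `quadraticTwist` (so `c₄, c₆` agree on the nose); `isElliptic_375705bp1`; `isGloballyMinimal_375705bp1` by Silverman's integer criterion
  (`gcd(Δ, c₄) = 1089 = 3²·11²`, `ord₃ Δ = 5`, `ord₁₁ Δ = 6 < 12`).
* §2 `bsdp3_d375705bp1` — `BSD(E,3)` for the rank-0 wild onto curve `375705bp1` (a member of the residual `WAllExclAddWildRankZero`'s habitat)
  from GZK and ONE certificate line `#Sel^(3)(E/ℚ) = 3 ^ r_an`, X4-record shape (`X11b.bsdp_of_ainvs_of_card_selmerGroup`).
* §3 `sigma_at_F0_of_bsdp_of_bsdp` — **J‴'s conclusion on EVERY F₀-frame** (any `Dt`, `H`, `ι`, non-torsion `P ↦ y_K`, any depth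
  `s′ ≤ ord₃ ∏ c_q + v₃ c(Dt)`, any square-free Zhang–Kolyvagin level `n` of index `≥ s′`, any Kolyvagin–Heegner datum `d`: `3^{s′} ∣ P(n)` in
  `E(K[n])`) from `BSDp W 3 ∧ BSDp 375705bp1 3` and {Gross–Zagier, Kolyvagin, GZK, modularity, GZ86 I.(7.3), MN19 Thm. 0.7-lower}.
* §4 `sigma_at_F0` — the same with the two `BSDp`'s replaced by their certificate inputs (`#Ш_an` a `3`-unit and the descent line, per curve;
  the twist's `r_an = 0` is PROVED from the frame's `L(E^{(−11)},1) ≠ 0` through `entireLFunction_smul`).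
* §5 `sigma_at_of_certificateLines` — the GENERIC consumer at any frame of the cell: two certificate lines + two `#Ш_an` unit lines + an explicit
  globally minimal model of the twist ⟹ J‴'s conclusion at the frame (the shape every further habitat instance plugs into).
NET: on F₀ the research crux J‴ holds, kernel-checked, modulo named print + two exact 3-descent certificate lines + two `#Ш_an` unit lines —
the first complete instance; a FALSIFIER of J‴ on F₀ would have been `dim Sel^(3)(375705bp1) ≥ 2` (it is `0`). HONEST FRAMING: one frame, not
the crux; nothing class-wide moves; BSD is not proved by any of this; J‴ / `stub_flatMultiCarrier` stay open research.

References: [GrossZagier1986] I (6.3), (7.3), V (2.2); [MatarNekovar2019] Thm. 0.7, §0.11; [McCallumLMS1991] §5; [Jetchev2008] Conj. 1.3;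
[Miller2011LMS] Def. 1.1; [SchaeferStoll2004]; [SilvermanAEC2009] VII.1 Remark 1.1, X.5 Cor. 5.4; [Cremona2006] (labels 3105c1, 375705bp1).
-/

set_option autoImplicit false
set_option linter.dupNamespace false -- `Summit.BirchSwinnertonDyer.BirchSwinnertonDyer.…` is the tree's layout (D-0017)

noncomputable section

open scoped Classical

namespace Summit.BirchSwinnertonDyer.BirchSwinnertonDyer.Theorems.WildSigmaDivisibilityAtThreeMultiCarrierInstanceF0

open WeierstrassCurve NumberField Literature.NumberTheory.EllipticCurves
  Literature.NumberTheory.EllipticCurves.ModularForms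
  Literature.NumberTheory.EllipticCurves.Rank1Residual
  Literature.NumberTheory.EllipticCurves.Rank1Residual.Typed
  Literature.NumberTheory.EllipticCurves.Rank1Residual.X11RankOneCertificates
  Summit.BirchSwinnertonDyer.Rank1Residual
  Summit.BirchSwinnertonDyer.Rank1Residual.Additive
  Summit.BirchSwinnertonDyer.Rank1Residual.X11b
  Summit.BirchSwinnertonDyer.Rank1Residual.X11b.Three
  Summit.BirchSwinnertonDyer.BirchSwinnertonDyer.Theorems.WildSigmaDivisibilityAtThreeMultiCarrierTight

/-! ## §1 The twist model `375705bp1` of `(3105c1)^{(−11)}`: explicit isomorphism, non-singularity, global minimality -/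

/-- **`⟨1, −3, 1/2, 0⟩ • (3105c1)^{(−11)} = 375705bp1` on the nose.** The tree's `quadraticTwist` of `[1,−1,1,−482,4214]` by `−11` is
`[0, 33/4, 0, −116523/2, −22436667/4]` (`c₄ = 2797641`, `c₆ = 4707854811`, equal to those of Cremona's `375705bp1`), and the integral change
of variables `u = 1, r = −3, s = 1/2, t = 0` lands exactly on `[1,−1,0,−58284,−5434335]`. (PARI re-check of the same identity through
`ellminimalmodel(elltwist(E,−11))` and `a_p` matching: kit j316201 `precheck.json`.) [cite: SilvermanAEC2009, X.5 Cor. 5.4 and III.1 Table 3.1] -/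
theorem smul_quadraticTwist_3105c1_eq :
    (⟨1, -3, 2⁻¹, 0⟩ : VariableChange ℚ) • (⟨1, -1, 1, -482, 4214⟩ : WeierstrassCurve ℚ).quadraticTwist (-11 : ℚ) =
      (⟨1, -1, 0, -58284, -5434335⟩ : WeierstrassCurve ℚ) := by
  ext <;> simp [quadraticTwist, variableChange_a₁, variableChange_a₂, variableChange_a₃, variableChange_a₄,
    variableChange_a₆, WeierstrassCurve.b₂, WeierstrassCurve.b₄, WeierstrassCurve.b₆] <;> norm_num

/-- `375705bp1` is an elliptic curve (`Δ = −154707100453125 = −3⁵·5⁶·11⁶·23 ≠ 0`, rechecked by the kernel). [cite: Cremona2006, Table 1 (label 375705bp1)] -/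
theorem isElliptic_375705bp1 : (⟨1, -1, 0, -58284, -5434335⟩ : WeierstrassCurve ℚ).IsElliptic :=
  isElliptic_of_discOf_ne_zero 1 (-1) 0 (-58284) (-5434335) (by decide +kernel)

/-- **Cremona's model `375705bp1` is globally minimal**, by Silverman's integer criterion at the primes of `gcd(Δ, c₄) = 1089 = 3²·11²`:
`ord₃ Δ = 5 < 12` and `ord₁₁ Δ = 6 < 12`. [cite: SilvermanAEC2009, VII.1 Remark 1.1] -/
theorem isGloballyMinimal_375705bp1 : (⟨1, -1, 0, -58284, -5434335⟩ : WeierstrassCurve ℚ).IsGloballyMinimal := by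
  refine isGloballyMinimal_of_int_criterion 1 (-1) 0 (-58284) (-5434335)
    (X5.Instances.int_criterion_of_primeFactors_gcd (by decide) ?_)
  have hg : (Int.gcd (discOf [1, -1, 0, -58284, -5434335]) (c4Of [1, -1, 0, -58284, -5434335])).primeFactors = {3, 11} := by
    rw [show Int.gcd (discOf [1, -1, 0, -58284, -5434335]) (c4Of [1, -1, 0, -58284, -5434335]) = 3 ^ 2 * 11 ^ 2 by decide,
      Nat.primeFactors_mul (by norm_num) (by norm_num), Nat.primeFactors_prime_pow (by norm_num) Nat.prime_three,
      Nat.primeFactors_prime_pow (by norm_num) (by norm_num)]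
    rfl
  rw [hg]; decide

/-! ## §2 `BSD(E,3)` for the rank-zero twist `375705bp1` from ONE exact 3-descent certificate line -/

/-- **`BSD(E,3)` for `375705bp1`** [EXACT] (`N = 375705 = 3³·5·11²·23`, additive (wild, Kodaira IV) at `3`; Cremona model `[1, −1, 0, −58284, −5434335]`;
`ρ̄_{E,3}` surjective; analytic rank `0` (`L(E,1) ≈ 5.52842`, root number `+1`); `#Ш_an = 1`; `∏ c_p = 36`, `#E(ℚ)_tors = 1` — Cremona `allbsd`, INPUTS)
from GZK and the certificate line `#Sel^(3)(E/ℚ) = 3 ^ r_an`: EXACT 3-descent (x11b `desc3lib.gp` sha256 c4fb20b7…, byte-identical, driver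
`entry.gp` gen 8 in EXACT mode `bnfcertify(A,1) = 1` + 3-saturation of the `S`-units by cubic characters; run UNCHANGED by this seat as
instrument row A-J3-F0 of crux J‴, kit j316201, `verified=True`): octic algebra `A = ℚ[x]/(ψ₃)` with `|d_A| ≈ 7.3·10^14`, `S = {3, 5, 11, 23}`,
`Cl(A) = [1, []]` CERTIFIED (`bnfcertify = 1`), `16` generators of `A(S,3)` (3-saturated by cubic characters), `dim H¹(ℚ,E[3];S) = 3`, local
images at every `ℓ ∈ S` reached, **`dim Sel^(3)(E/ℚ) = 0 = rank`** (PARI analytic-rank datum `[0, 5.52842069725029]`), mode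
`EXACT(bnfcertify1+3sat)`, 1.45 s ⟹ **`#Sel^(3)(E/ℚ) = 3^0`**. Same job, same engine: `3105c1` re-certified `dim Sel^(3) = 1 = rank` (EXACT;
agrees with the tree record's kit j127101). Kernel: `Δ ≠ 0`. Binders: `hGZK`, `r_an ≤ 1`, `#Ш_an` a `3`-unit, `hSel`. This curve is a member of the habitat of the route's residual `WAllExclAddWildRankZero` (non-CM, O6 at `3`, `r_an = 0`).
[cite: Miller2011LMS, §1 and Def. 1.1] [cite: Cremona2006, Table 1 (Cremona label 375705bp1)] [cite: SchaeferStoll2004, §5] -/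
theorem bsdp3_d375705bp1 (hGZK : rank_eq_analyticRank_of_analyticRank_le_one)
    (W : WeierstrassCurve ℚ) (hW : W = ⟨1, -1, 0, -58284, -5434335⟩)
    (hr : W.analyticRank ≤ 1) {q : ℚ} (hq : shaAn W = (q : ℂ)) (hv : padicValRat 3 q = 0)
    (hSel : Nat.card (W.selmerGroup (3 : ℤ)) = 3 ^ W.analyticRank) : BSDp W 3 := by
  subst hW
  haveI : Fact (Nat.Prime 3) := ⟨by norm_num⟩
  exact bsdp_of_ainvs_of_card_selmerGroup hGZK 1 (-1) 0 (-58284) (-5434335) (by decide +kernel) 3 hr hq hv hSel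

/-! ## §3 J‴'s conclusion on every F₀-frame from the two `BSD₃`'s and named print -/

/-- **J‴ ON F₀ FROM THE TWO BSD₃'s.** For every frame of the crux over F₀ — `W` the Cremona model of `3105c1` (onto wild `r = 1`, conductor `N`),
`K` with `d_K = −11`, ANY modular parametrisation datum `Dt` of level `N`, Heegner datum `H`, embedding `ι`, non-torsion `P ↦ y_K` — the two
Miller statements `BSD(3105c1, 3)` and `BSD(375705bp1, 3)` together with {Gross–Zagier I.(6.3), Kolyvagin, GZK, modularity, GZ86 I.(7.3),
Matar–Nekovář Thm. 0.7-lower} give J‴'s conclusion there: `3^{s′} ∣ P(n)` in `E(K[n])` for every `s′ ≤ ord₃ ∏ c_q + v₃ c(Dt)`, every square-free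
Zhang–Kolyvagin level `n` of index `≥ s′` and every Kolyvagin–Heegner datum `d` of conductor `n`. (J‴'s remaining binders `Odd d_K`, `d_K ≠ −3`
hold for `−11`; the multi-carrier cut holds on F₀ — `c₃ = 3`, `c₅ = 6`, `c₂₃ = 1`, `t = 2` — but is not needed by the Tight term, which serves
every frame.) CONDITIONAL on the two `BSDp`'s and the six named facts; one frame, not the crux. [cite: GrossZagier1986, Thm. I.(6.3), (7.3) and V (2.2)]
[cite: MatarNekovar2019, Thm. 0.7 (p. 456) and §0.11 (p. 457)] [cite: Jetchev2008, Conj. 1.3 (p. 812)] -/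
theorem sigma_at_F0_of_bsdp_of_bsdp
    (hGZ : ∀ (N : ℕ) [NeZero N] (W : WeierstrassCurve ℚ) (K : Type) [Field K] [NumberField K],
      gross_zagier N W K)
    (hKo : ∀ (N : ℕ) [NeZero N] (W : WeierstrassCurve ℚ) (K : Type) [Field K] [NumberField K],
      kolyvagin N W K)
    (hGZK : rank_eq_analyticRank_of_analyticRank_le_one) (hmod : hasEntireLFunction_rat)
    (hGZ73 : GrossZagier1986_thm_I_7_3)
    (hMNlow : MatarNekovar2019.thm07_pow_dvd_card_sha_primary_of_certificate_of_irreducible)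
    (W : WeierstrassCurve ℚ) [W.IsElliptic] [W.IsGloballyMinimal] (N : ℕ) [NeZero N] (K : Type) [Field K]
    [NumberField K] (Dt : ModularParametrizationData W N) (H : HeegnerDatum N (NumberField.discr K))
    (ι : K →+* ℂ) (P : (W.baseChange K).toAffine.Point)
    (hW : W = ⟨1, -1, 1, -482, 4214⟩) (hD : NumberField.discr K = -11)
    (hO6 : ClassO6 W 3) (hsurj : W.HasSurjectiveModNGaloisRep 3) (hr : W.analyticRank = 1) (hN : W.conductorNorm ℤ = N)
    (hK : IsImaginaryQuadratic K) (hHH : SatisfiesHeegnerHypothesis N K)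
    (hLd : (W.quadraticTwist (NumberField.discr K : ℚ)).entireLFunction 1 ≠ 0)
    (hP : WeierstrassCurve.Affine.Point.map ι.toRatAlgHom P = heegnerPointComplex Dt H) (hnt : ¬ IsOfFinAddOrder P)
    (hbsd : BSDp W 3) (hbsdd : BSDp (⟨1, -1, 0, -58284, -5434335⟩ : WeierstrassCurve ℚ) 3) :
    ∀ (s' : ℕ), s' ≤ padicValNat 3 W.tamagawaProduct + padicValNat 3 Dt.c.natAbs →
      ∀ (n : ℕ) (d : KolyvaginHeegnerData Dt H.β ι n), Squarefree n →
        (∀ ℓ ∈ n.primeFactors, Zhang2014.IsKolyvaginPrime N W K 3 ℓ ∧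
          s' ≤ Zhang2014.kolyvaginIndex W 3 ℓ) → Koly.PDiv d 3 s' := by
  subst hN
  haveI := isElliptic_375705bp1
  haveI := isGloballyMinimal_375705bp1
  have hodd : Odd (NumberField.discr K) := by rw [hD]; decide
  have h3 : NumberField.discr K ≠ -3 := by rw [hD]; decide
  have hC : ∃ C : VariableChange ℚ, C • W.quadraticTwist (NumberField.discr K : ℚ) =
      (⟨1, -1, 0, -58284, -5434335⟩ : WeierstrassCurve ℚ) := by
    refine ⟨⟨1, -3, 2⁻¹, 0⟩, ?_⟩
    rw [hD, hW]; push_cast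
    exact smul_quadraticTwist_3105c1_eq
  exact sigma_at_of_bsdp_of_bsdp_towerFree hGZ hKo hGZK hmod hGZ73 hMNlow W K Dt H ι P
    (⟨1, -1, 0, -58284, -5434335⟩ : WeierstrassCurve ℚ) hO6 hsurj hr hK hHH hLd hP hnt hodd h3 hC hbsd hbsdd

/-! ## §4 … and from the certificate inputs themselves -/

/-- **J‴ ON F₀ FROM THE TWO CERTIFICATE LINES** — §3 with `BSD(3105c1,3)` supplied by the tree record `X4.bsdp3_d3105c1` (kit j127101: EXACT
3-descent, `dim Sel^(3) = 1 = r_an`) and `BSD(375705bp1,3)` by §2 (kit j316201: EXACT 3-descent, `dim Sel^(3) = 0`); the twist's `r_an = 0` is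
proved here from the frame's `L(E^{(−11)},1) ≠ 0` (`entireLFunction_smul` along §1's isomorphism). Displayed non-kernel inputs per curve: `#Ш_an`
is a rational `3`-unit (`hq/hv`, `hqd/hvd`: Cremona `#Ш_an = 1` for both) and the certificate line (`hSel`: `#Sel^(3)(3105c1) = 3^{r_an}`;
`hSeld`: `#Sel^(3)(375705bp1) = 1`). CONDITIONAL on those four lines and the six named facts; one frame, not the crux; BSD is not proved by this.
[cite: Miller2011LMS, §1 and Def. 1.1] [cite: GrossZagier1986, Thm. I.(6.3), (7.3) and V (2.2)] [cite: MatarNekovar2019, Thm. 0.7 and §0.11] -/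
theorem sigma_at_F0
    (hGZ : ∀ (N : ℕ) [NeZero N] (W : WeierstrassCurve ℚ) (K : Type) [Field K] [NumberField K],
      gross_zagier N W K)
    (hKo : ∀ (N : ℕ) [NeZero N] (W : WeierstrassCurve ℚ) (K : Type) [Field K] [NumberField K],
      kolyvagin N W K)
    (hGZK : rank_eq_analyticRank_of_analyticRank_le_one) (hmod : hasEntireLFunction_rat)
    (hGZ73 : GrossZagier1986_thm_I_7_3)
    (hMNlow : MatarNekovar2019.thm07_pow_dvd_card_sha_primary_of_certificate_of_irreducible)
    (W : WeierstrassCurve ℚ) [W.IsElliptic] [W.IsGloballyMinimal] (N : ℕ) [NeZero N] (K : Type) [Field K]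
    [NumberField K] (Dt : ModularParametrizationData W N) (H : HeegnerDatum N (NumberField.discr K))
    (ι : K →+* ℂ) (P : (W.baseChange K).toAffine.Point)
    (hW : W = ⟨1, -1, 1, -482, 4214⟩) (hD : NumberField.discr K = -11)
    (hO6 : ClassO6 W 3) (hsurj : W.HasSurjectiveModNGaloisRep 3) (hr : W.analyticRank = 1) (hN : W.conductorNorm ℤ = N)
    (hK : IsImaginaryQuadratic K) (hHH : SatisfiesHeegnerHypothesis N K)
    (hLd : (W.quadraticTwist (NumberField.discr K : ℚ)).entireLFunction 1 ≠ 0)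
    (hP : WeierstrassCurve.Affine.Point.map ι.toRatAlgHom P = heegnerPointComplex Dt H) (hnt : ¬ IsOfFinAddOrder P)
    {q : ℚ} (hq : shaAn W = (q : ℂ)) (hv : padicValRat 3 q = 0)
    (hSel : Nat.card (W.selmerGroup (3 : ℤ)) = 3 ^ W.analyticRank)
    {qd : ℚ} (hqd : shaAn (⟨1, -1, 0, -58284, -5434335⟩ : WeierstrassCurve ℚ) = (qd : ℂ)) (hvd : padicValRat 3 qd = 0)
    (hSeld : Nat.card ((⟨1, -1, 0, -58284, -5434335⟩ : WeierstrassCurve ℚ).selmerGroup (3 : ℤ)) = 1) :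
    ∀ (s' : ℕ), s' ≤ padicValNat 3 W.tamagawaProduct + padicValNat 3 Dt.c.natAbs →
      ∀ (n : ℕ) (d : KolyvaginHeegnerData Dt H.β ι n), Squarefree n →
        (∀ ℓ ∈ n.primeFactors, Zhang2014.IsKolyvaginPrime N W K 3 ℓ ∧
          s' ≤ Zhang2014.kolyvaginIndex W 3 ℓ) → Koly.PDiv d 3 s' := by
  haveI := isElliptic_375705bp1
  -- `BSD(3105c1, 3)` from the tree record (kit j127101)
  have hbsd : BSDp W 3 := X4.bsdp3_d3105c1 hGZK W hW hr.le hq hv hSel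
  -- the twist's analytic rank is `0`: `L(375705bp1, 1) = L((3105c1)^{(−11)}, 1) ≠ 0` along §1's isomorphism
  have hD0 : ((NumberField.discr K : ℤ) : ℚ) ≠ 0 := by rw [hD]; norm_num
  haveI : (W.quadraticTwist (NumberField.discr K : ℚ)).IsElliptic := W.isElliptic_quadraticTwist hD0
  have hCW : (⟨1, -3, 2⁻¹, 0⟩ : VariableChange ℚ) • W.quadraticTwist (NumberField.discr K : ℚ) =
      (⟨1, -1, 0, -58284, -5434335⟩ : WeierstrassCurve ℚ) := by
    rw [hD, hW]; push_cast; exact smul_quadraticTwist_3105c1_eq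
  have hLd1 : (⟨1, -1, 0, -58284, -5434335⟩ : WeierstrassCurve ℚ).entireLFunction 1 ≠ 0 := by
    rw [← hCW, entireLFunction_smul]; exact hLd
  have hrd : (⟨1, -1, 0, -58284, -5434335⟩ : WeierstrassCurve ℚ).analyticRank = 0 :=
    analyticRank_eq_zero_of_entireLFunction_one_ne_zero hLd1
  have hbsdd : BSDp (⟨1, -1, 0, -58284, -5434335⟩ : WeierstrassCurve ℚ) 3 :=
    bsdp3_d375705bp1 hGZK _ rfl (by rw [hrd]; exact zero_le_one) hqd hvd (by rw [hrd, pow_zero]; exact hSeld)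
  exact sigma_at_F0_of_bsdp_of_bsdp hGZ hKo hGZK hmod hGZ73 hMNlow W N K Dt H ι P hW hD hO6 hsurj hr hN hK hHH hLd hP hnt hbsd hbsdd

/-! ## §5 The generic consumer: J‴'s conclusion at ANY frame of the cell from two certificate lines (for the next instances) -/

/-- **J‴ AT A FRAME FROM TWO EXACT-DESCENT CERTIFICATE LINES (generic).** At any frame of the onto wild `r = 1` cell at `3` (level `N = N_E`,
admissible `K`: imaginary quadratic, Heegner, `d_K` odd `≠ −3`, `L(E^{d_K},1) ≠ 0`; `Dt`, `H`, `ι`, non-torsion `P ↦ y_K`) with an explicit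
globally minimal integral model `Wd` of the twist (`C • E^{(d_K)} = Wd`): the class-free consumer
`Typed.bsdp_of_card_selmerGroup_eq_pow_analyticRank` (Mordell–Weil + the fundamental exact sequence + GZK) turns the two displayed lines
`#Sel^(3)(E/ℚ) = 3^{r_an(E)}`, `#Sel^(3)(Wd/ℚ) = 1` and the two `#Ш_an` unit lines into `BSDp W 3 ∧ BSDp Wd 3` (the twist's `r_an = 0` is
proved from `L(E^{d_K},1) ≠ 0` along `C`), and the Tight term `sigma_at_of_bsdp_of_bsdp_towerFree` gives J‴'s conclusion at the frame modulo
{Gross–Zagier, Kolyvagin, GZK, modularity, GZ86 I.(7.3), MN19 Thm. 0.7-lower}. This is the shape every further habitat instance (one exact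
3-descent on `E^{(D)}` per frame, the `E`-side line being the X4 census record) plugs into. CONDITIONAL; nothing asserted about any curve.
[cite: Miller2011LMS, §1 and Def. 1.1] [cite: GrossZagier1986, Thm. I.(6.3), (7.3) and V (2.2)] [cite: MatarNekovar2019, Thm. 0.7 and §0.11] -/
theorem sigma_at_of_certificateLines
    (hGZ : ∀ (N : ℕ) [NeZero N] (W : WeierstrassCurve ℚ) (K : Type) [Field K] [NumberField K],
      gross_zagier N W K)
    (hKo : ∀ (N : ℕ) [NeZero N] (W : WeierstrassCurve ℚ) (K : Type) [Field K] [NumberField K],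
      kolyvagin N W K)
    (hGZK : rank_eq_analyticRank_of_analyticRank_le_one) (hmod : hasEntireLFunction_rat)
    (hGZ73 : GrossZagier1986_thm_I_7_3)
    (hMNlow : MatarNekovar2019.thm07_pow_dvd_card_sha_primary_of_certificate_of_irreducible)
    (W : WeierstrassCurve ℚ) [W.IsElliptic] [W.IsGloballyMinimal] (N : ℕ) [NeZero N] (K : Type) [Field K]
    [NumberField K] (Dt : ModularParametrizationData W N) (H : HeegnerDatum N (NumberField.discr K))
    (ι : K →+* ℂ) (P : (W.baseChange K).toAffine.Point)
    (Wd : WeierstrassCurve ℚ) [Wd.IsElliptic] [Wd.IsGloballyMinimal]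
    (hO6 : ClassO6 W 3) (hsurj : W.HasSurjectiveModNGaloisRep 3) (hr : W.analyticRank = 1) (hN : W.conductorNorm ℤ = N)
    (hK : IsImaginaryQuadratic K) (hHH : SatisfiesHeegnerHypothesis N K)
    (hLd : (W.quadraticTwist (NumberField.discr K : ℚ)).entireLFunction 1 ≠ 0)
    (hP : WeierstrassCurve.Affine.Point.map ι.toRatAlgHom P = heegnerPointComplex Dt H) (hnt : ¬ IsOfFinAddOrder P)
    (hodd : Odd (NumberField.discr K)) (h3 : NumberField.discr K ≠ -3)
    (hC : ∃ C : VariableChange ℚ, C • W.quadraticTwist (NumberField.discr K : ℚ) = Wd)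
    {q : ℚ} (hq : shaAn W = (q : ℂ)) (hv : padicValRat 3 q = 0)
    (hSel : Nat.card (W.selmerGroup (3 : ℤ)) = 3 ^ W.analyticRank)
    {qd : ℚ} (hqd : shaAn Wd = (qd : ℂ)) (hvd : padicValRat 3 qd = 0)
    (hSeld : Nat.card (Wd.selmerGroup (3 : ℤ)) = 1) :
    ∀ (s' : ℕ), s' ≤ padicValNat 3 W.tamagawaProduct + padicValNat 3 Dt.c.natAbs →
      ∀ (n : ℕ) (d : KolyvaginHeegnerData Dt H.β ι n), Squarefree n →
        (∀ ℓ ∈ n.primeFactors, Zhang2014.IsKolyvaginPrime N W K 3 ℓ ∧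
          s' ≤ Zhang2014.kolyvaginIndex W 3 ℓ) → Koly.PDiv d 3 s' := by
  subst hN
  haveI : Fact (Nat.Prime 3) := ⟨Nat.prime_three⟩
  have hbsd : BSDp W 3 := bsdp_of_card_selmerGroup_eq_pow_analyticRank W 3 hGZK hr.le hq hv hSel
  have hD0 : ((NumberField.discr K : ℤ) : ℚ) ≠ 0 := by exact_mod_cast NumberField.discr_ne_zero K
  haveI : (W.quadraticTwist (NumberField.discr K : ℚ)).IsElliptic := W.isElliptic_quadraticTwist hD0
  obtain ⟨C, hCW⟩ := hC
  have hLd1 : Wd.entireLFunction 1 ≠ 0 := by rw [← hCW, entireLFunction_smul]; exact hLd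
  have hrd : Wd.analyticRank = 0 := analyticRank_eq_zero_of_entireLFunction_one_ne_zero hLd1
  have hbsdd : BSDp Wd 3 := bsdp_of_card_selmerGroup_eq_pow_analyticRank Wd 3 hGZK (by rw [hrd]; exact zero_le_one) hqd hvd
    (by rw [hrd, pow_zero]; exact hSeld)
  exact sigma_at_of_bsdp_of_bsdp_towerFree hGZ hKo hGZK hmod hGZ73 hMNlow W K Dt H ι P Wd hO6 hsurj hr hK hHH hLd hP hnt hodd h3
    ⟨C, hCW⟩ hbsd hbsdd

end Summit.BirchSwinnertonDyer.BirchSwinnertonDyer.Theorems.WildSigmaDivisibilityAtThreeMultiCarrierInstanceF0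

end
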